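import Summits.ValiantsHypothesis.ValiantsHypothesis.Theorems.KPlusLogSqLawMixedGaugeCubeLoewnerIntegrals

/-!
# Route «KPlusLogSqLaw», `WeakLifting` (stmt-ValiantsHypothesis-19561) — integrals for the `t^{2/3}` Loewner kernel:
# `∫₀^∞ μ⁴ dμ / ((a³ + μ³)(b³ + μ³)) = I₂ (a + b)/(a² + ab + b²)`, `I₂ = ∫₀^∞ s ds / (1 + s³)`

HONEST FRAMING.  Helper file (seat val-sym-lift-p4 g26, cell `pub-symmetroid`, 2026-08-29; `--supports 19561 --as helper`, zero crux
credit).  Pure real analysis, companion of `…MixedGaugeCubeLoewnerIntegrals`: the Gram-integral representation of the kernel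
`(a + b)/(a² + ab + b²)` on `(0, ∞)` (the Loewner matrix of `t ↦ t^{2/3}` at `a³, b³`), which the file `…MixedGaugeTwoThirdsLoewnerKernel`
turns into the hypothesis `hK` of the two-class law at ratio 3 : 2 (`MixedGauge.card_posZeros_le_blocks_threeHalves_of_loewner`).
Contents: integrability of `μ/(a³+μ³)`, `a²μ/(a³+μ³)`, `μ⁴/((a³+μ³)(b³+μ³))` on `(0,∞)`; `integral_lin_scale` (`∫ a²μ/(a³+μ³) = a·I₂`);
`integral_lin`; `integral_pair4_of_ne` (partial fractions); `integral_pair4_self` (`∫ μ⁴/(a³+μ³)² = 2I₂/(3a)`, FTC on `(0,∞)` with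
`G(μ) = −μ²/(3(a³+μ³))`); `integral_pair4`; `I2_pos`.  Nothing here is about `WeakLifting` / `TropicalB`, the doors,
`MatrixDescartes` (18050) or VP ≠ VNP.  No `def`; axioms standard.  [folklore calculus]
-/

set_option linter.dupNamespace false
set_option autoImplicit false

namespace Summit.ValiantsHypothesis.ValiantsHypothesis.Theorems.KPlusLogSqLaw

open MeasureTheory Set Filter Topology
open scoped BigOperators

namespace MixedGauge

/-! ## 1. Integrability -/

/-- `μ ≤ μ³ + 1` for `μ ≥ 0`. -/
theorem le_cube_add_one (μ : ℝ) (hμ : 0 ≤ μ) : μ ≤ μ ^ 3 + 1 := by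
  nlinarith [mul_nonneg hμ (sq_nonneg (μ - 1)), sq_nonneg (μ - 1 / 2)]

/-- `μ/(a³ + μ³) ≤ ((2a³ + 1)/a³)·(1 + μ²)⁻¹` for `a, μ > 0`. -/
theorem lin_ratio_le (a μ : ℝ) (ha : 0 < a) (hμ : 0 < μ) :
    μ / (a ^ 3 + μ ^ 3) ≤ (2 * a ^ 3 + 1) / a ^ 3 * (1 + μ ^ 2)⁻¹ := by
  have ha3 : 0 < a ^ 3 := by positivity
  have hD : 0 < a ^ 3 + μ ^ 3 := by positivity
  have h1 : 0 < 1 + μ ^ 2 := by positivity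
  rw [← div_eq_mul_inv, div_div, div_le_div_iff₀ hD (by positivity)]
  have := le_cube_add_one μ hμ.le
  nlinarith [mul_nonneg ha3.le hμ.le, mul_nonneg ha3.le (pow_pos hμ 3).le, pow_pos hμ 3, mul_pos ha3 ha3]

/-- `μ/(a³ + μ³)` is integrable on `(0,∞)` (`a > 0`). -/
theorem integrableOn_lin_cube (a : ℝ) (ha : 0 < a) : IntegrableOn (fun μ : ℝ => μ / (a ^ 3 + μ ^ 3)) (Ioi 0) := by
  refine integrableOn_Ioi_of_le_inv_one_add_sq ((2 * a ^ 3 + 1) / a ^ 3) ?_ ?_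
  · refine ContinuousOn.div (by fun_prop) (by fun_prop) ?_
    intro μ hμ
    have : 0 < μ := hμ
    positivity
  · intro μ hμ
    have hμ' : 0 < μ := hμ
    rw [abs_of_nonneg (by positivity)]
    exact lin_ratio_le a μ ha hμ'

/-- `a²μ/(a³ + μ³)` is integrable on `(0,∞)`. -/
theorem integrableOn_lin_cube_scaled (a : ℝ) (ha : 0 < a) :
    IntegrableOn (fun μ : ℝ => a ^ 2 * μ / (a ^ 3 + μ ^ 3)) (Ioi 0) := by
  have h : IntegrableOn (fun μ : ℝ => a ^ 2 * (μ / (a ^ 3 + μ ^ 3))) (Ioi 0) :=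
    (integrableOn_lin_cube a ha).const_mul (a ^ 2)
  refine IntegrableOn.congr_fun h ?_ measurableSet_Ioi
  intro μ _
  simp only
  ring

/-- `μ⁴/((a³ + μ³)(b³ + μ³))` is integrable on `(0,∞)`. -/
theorem integrableOn_pair4 (a b : ℝ) (ha : 0 < a) (hb : 0 < b) :
    IntegrableOn (fun μ : ℝ => μ ^ 4 / ((a ^ 3 + μ ^ 3) * (b ^ 3 + μ ^ 3))) (Ioi 0) := by
  refine integrableOn_Ioi_of_le_inv_one_add_sq ((2 * b ^ 3 + 1) / b ^ 3) ?_ ?_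
  · refine ContinuousOn.div (by fun_prop) (by fun_prop) ?_
    intro μ hμ
    have : 0 < μ := hμ
    positivity
  · intro μ hμ
    have hμ' : 0 < μ := hμ
    have hA : 0 < a ^ 3 + μ ^ 3 := by positivity
    have hB : 0 < b ^ 3 + μ ^ 3 := by positivity
    rw [abs_of_nonneg (by positivity)]
    have h1 : μ ^ 4 / ((a ^ 3 + μ ^ 3) * (b ^ 3 + μ ^ 3)) ≤ μ / (b ^ 3 + μ ^ 3) := by
      rw [div_le_div_iff₀ (by positivity) hB]
      nlinarith [pow_pos ha 3, pow_pos hμ' 3, pow_pos hμ' 4, mul_pos (pow_pos ha 3) hμ']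
    exact h1.trans (lin_ratio_le b μ hb hμ')

/-! ## 2. Scaling: `∫ a²μ/(a³ + μ³) = a·I₂`, `∫ μ/(a³ + μ³) = I₂/a` -/

/-- `∫_{(0,∞)} a²μ/(a³ + μ³) dμ = a · I₂`. -/
theorem integral_lin_scale (a : ℝ) (ha : 0 < a) :
    ∫ μ in Ioi (0:ℝ), a ^ 2 * μ / (a ^ 3 + μ ^ 3) = a * ∫ s in Ioi (0:ℝ), s / (1 + s ^ 3) := by
  have h := integral_comp_mul_left_Ioi (fun s : ℝ => s / (1 + s ^ 3)) 0 (inv_pos.mpr ha)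
  simp only [mul_zero, inv_inv, smul_eq_mul] at h
  rw [← h]
  refine setIntegral_congr_fun measurableSet_Ioi ?_
  intro μ hμ
  have hμ' : 0 < μ := hμ
  have ha3 : a ^ 3 ≠ 0 := by positivity
  have ha0 : a ≠ 0 := ne_of_gt ha
  simp only
  rw [mul_pow, inv_pow]
  field_simp

/-- `∫_{(0,∞)} μ/(a³ + μ³) dμ = I₂ / a`. -/
theorem integral_lin (a : ℝ) (ha : 0 < a) :
    ∫ μ in Ioi (0:ℝ), μ / (a ^ 3 + μ ^ 3) = (∫ s in Ioi (0:ℝ), s / (1 + s ^ 3)) / a := by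
  have ha0 : a ≠ 0 := ne_of_gt ha
  have h1 : ∫ μ in Ioi (0:ℝ), μ / (a ^ 3 + μ ^ 3) = ∫ μ in Ioi (0:ℝ), (a ^ 2)⁻¹ * (a ^ 2 * μ / (a ^ 3 + μ ^ 3)) := by
    refine setIntegral_congr_fun measurableSet_Ioi ?_
    intro μ hμ
    simp only
    field_simp
  rw [h1, integral_const_mul, integral_lin_scale a ha]
  field_simp

/-! ## 3. The pair integral, `a ≠ b` -/

/-- `∫_{(0,∞)} μ⁴ dμ /((a³ + μ³)(b³ + μ³)) = I₂ (a + b)/(a² + ab + b²)` for `0 < a`, `0 < b`, `a ≠ b`. -/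
theorem integral_pair4_of_ne (a b : ℝ) (ha : 0 < a) (hb : 0 < b) (hab : a ≠ b) :
    ∫ μ in Ioi (0:ℝ), μ ^ 4 / ((a ^ 3 + μ ^ 3) * (b ^ 3 + μ ^ 3)) =
      (∫ s in Ioi (0:ℝ), s / (1 + s ^ 3)) * (a + b) / (a ^ 2 + a * b + b ^ 2) := by
  have hab3 : b ^ 3 - a ^ 3 ≠ 0 := by
    intro h
    have h' : b ^ 3 = a ^ 3 := sub_eq_zero.mp h
    have := (pow_left_inj₀ hb.le ha.le (by norm_num : (3:ℕ) ≠ 0)).mp h'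
    exact hab this.symm
  have hpt : ∀ μ ∈ Ioi (0:ℝ), μ ^ 4 / ((a ^ 3 + μ ^ 3) * (b ^ 3 + μ ^ 3)) =
      (b ^ 3 - a ^ 3)⁻¹ * (b * (b ^ 2 * μ / (b ^ 3 + μ ^ 3)) - a * (a ^ 2 * μ / (a ^ 3 + μ ^ 3))) := by
    intro μ hμ
    have hμ' : 0 < μ := hμ
    have hA : a ^ 3 + μ ^ 3 ≠ 0 := by positivity
    have hB : b ^ 3 + μ ^ 3 ≠ 0 := by positivity
    field_simp
    ring
  rw [setIntegral_congr_fun measurableSet_Ioi hpt, integral_const_mul,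
    integral_sub ((integrableOn_lin_cube_scaled b hb).const_mul b) ((integrableOn_lin_cube_scaled a ha).const_mul a),
    integral_const_mul, integral_const_mul, integral_lin_scale b hb, integral_lin_scale a ha]
  have hq : a ^ 2 + a * b + b ^ 2 ≠ 0 := by positivity
  field_simp
  ring

/-! ## 4. The pair integral, `a = b` -/

/-- `∫_{(0,∞)} μ⁴ dμ /(a³ + μ³)² = 2I₂/(3a)`: `μ⁴/(a³+μ³)² = G'(μ) + (2/3)·μ/(a³+μ³)` with `G(μ) = −μ²/(3(a³+μ³))`. -/
theorem integral_pair4_self (a : ℝ) (ha : 0 < a) :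
    ∫ μ in Ioi (0:ℝ), μ ^ 4 / ((a ^ 3 + μ ^ 3) * (a ^ 3 + μ ^ 3)) =
      (∫ s in Ioi (0:ℝ), s / (1 + s ^ 3)) * (a + a) / (a ^ 2 + a * a + a ^ 2) := by
  have ha3 : 0 < a ^ 3 := by positivity
  have hderiv : ∀ μ ∈ Ioi (0:ℝ), HasDerivAt (fun μ : ℝ => -(μ * μ) / (3 * (a ^ 3 + μ ^ 3)))
      ((-(1 * μ + μ * 1) * (3 * (a ^ 3 + μ ^ 3)) - (-(μ * μ)) * (3 * (3 * μ ^ 2))) / (3 * (a ^ 3 + μ ^ 3)) ^ 2) μ := by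
    intro μ hμ
    have hμ' : 0 < μ := hμ
    have hD : 3 * (a ^ 3 + μ ^ 3) ≠ 0 := by positivity
    have hnum : HasDerivAt (fun μ : ℝ => -(μ * μ)) (-(1 * μ + μ * 1)) μ :=
      ((hasDerivAt_id' μ).mul (hasDerivAt_id' μ)).neg
    have hden : HasDerivAt (fun μ : ℝ => 3 * (a ^ 3 + μ ^ 3)) (3 * (3 * μ ^ 2)) μ := by
      have h := ((hasDerivAt_pow 3 μ).const_add (a ^ 3)).const_mul 3
      simpa using h
    exact hnum.div hden hD
  have hG'int : IntegrableOn (fun μ : ℝ => (-(1 * μ + μ * 1) * (3 * (a ^ 3 + μ ^ 3)) - (-(μ * μ)) * (3 * (3 * μ ^ 2))) /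
      (3 * (a ^ 3 + μ ^ 3)) ^ 2) (Ioi 0) := by
    refine integrableOn_Ioi_of_le_inv_one_add_sq ((2 * a ^ 3 + 1) / a ^ 3) ?_ ?_
    · refine ContinuousOn.div (by fun_prop) (by fun_prop) ?_
      intro μ hμ
      have : 0 < μ := hμ
      positivity
    · intro μ hμ
      have hμ' : 0 < μ := hμ
      have hD : 0 < a ^ 3 + μ ^ 3 := by positivity
      have hbound : |(-(1 * μ + μ * 1) * (3 * (a ^ 3 + μ ^ 3)) - (-(μ * μ)) * (3 * (3 * μ ^ 2))) / (3 * (a ^ 3 + μ ^ 3)) ^ 2|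
          ≤ μ / (a ^ 3 + μ ^ 3) := by
        rw [abs_div, abs_of_pos (by positivity : (0:ℝ) < (3 * (a ^ 3 + μ ^ 3)) ^ 2), div_le_div_iff₀ (by positivity) hD]
        have habs : |(-(1 * μ + μ * 1) * (3 * (a ^ 3 + μ ^ 3)) - (-(μ * μ)) * (3 * (3 * μ ^ 2)))| ≤ 6 * μ * (a ^ 3 + μ ^ 3) := by
          rw [abs_le]
          constructor <;> nlinarith [pow_pos ha 3, pow_pos hμ' 3, pow_pos hμ' 4, mul_pos hμ' (pow_pos ha 3)]
        calc |(-(1 * μ + μ * 1) * (3 * (a ^ 3 + μ ^ 3)) - (-(μ * μ)) * (3 * (3 * μ ^ 2)))| * (a ^ 3 + μ ^ 3)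
            ≤ (6 * μ * (a ^ 3 + μ ^ 3)) * (a ^ 3 + μ ^ 3) := mul_le_mul_of_nonneg_right habs hD.le
          _ ≤ μ * (3 * (a ^ 3 + μ ^ 3)) ^ 2 := by nlinarith [pow_pos ha 3, pow_pos hμ' 3, mul_pos hμ' (mul_pos hD hD)]
      exact hbound.trans (lin_ratio_le a μ ha hμ')
  have hcont : ContinuousWithinAt (fun μ : ℝ => -(μ * μ) / (3 * (a ^ 3 + μ ^ 3))) (Ici 0) 0 := by
    refine ContinuousAt.continuousWithinAt ?_
    refine ContinuousAt.div (by fun_prop) (by fun_prop) ?_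
    positivity
  have htend : Tendsto (fun μ : ℝ => -(μ * μ) / (3 * (a ^ 3 + μ ^ 3))) atTop (𝓝 0) := by
    refine squeeze_zero_norm' ?_ tendsto_inv_atTop_zero
    filter_upwards [eventually_gt_atTop (0:ℝ)] with μ hμ
    rw [Real.norm_eq_abs, abs_div, abs_neg, abs_of_pos (mul_pos hμ hμ),
      abs_of_pos (by positivity : (0:ℝ) < 3 * (a ^ 3 + μ ^ 3)), div_le_iff₀ (by positivity : (0:ℝ) < 3 * (a ^ 3 + μ ^ 3)),
      inv_mul_eq_div, le_div_iff₀ hμ]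
    nlinarith [pow_pos ha 3, pow_pos hμ 3]
  have hFTC := integral_Ioi_of_hasDerivAt_of_tendsto hcont hderiv hG'int htend
  simp only [mul_zero, neg_zero, zero_div, sub_zero] at hFTC
  have hpt : ∀ μ ∈ Ioi (0:ℝ), μ ^ 4 / ((a ^ 3 + μ ^ 3) * (a ^ 3 + μ ^ 3)) =
      (-(1 * μ + μ * 1) * (3 * (a ^ 3 + μ ^ 3)) - (-(μ * μ)) * (3 * (3 * μ ^ 2))) / (3 * (a ^ 3 + μ ^ 3)) ^ 2
        + (2 / 3) * (μ / (a ^ 3 + μ ^ 3)) := by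
    intro μ hμ
    have hμ' : 0 < μ := hμ
    have hD : a ^ 3 + μ ^ 3 ≠ 0 := by positivity
    field_simp
    ring
  rw [setIntegral_congr_fun measurableSet_Ioi hpt, integral_add hG'int ((integrableOn_lin_cube a ha).const_mul _),
    hFTC, integral_const_mul, integral_lin a ha]
  have ha0 : a ≠ 0 := ne_of_gt ha
  field_simp
  ring

/-! ## 5. Both cases, and positivity of `I₂` -/

/-- `∫_{(0,∞)} μ⁴ dμ /((a³ + μ³)(b³ + μ³)) = I₂ (a + b)/(a² + ab + b²)` for all `a, b > 0`. -/
theorem integral_pair4 (a b : ℝ) (ha : 0 < a) (hb : 0 < b) :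
    ∫ μ in Ioi (0:ℝ), μ ^ 4 / ((a ^ 3 + μ ^ 3) * (b ^ 3 + μ ^ 3)) =
      (∫ s in Ioi (0:ℝ), s / (1 + s ^ 3)) * (a + b) / (a ^ 2 + a * b + b ^ 2) := by
  by_cases hab : a = b
  · subst hab
    exact integral_pair4_self a ha
  · exact integral_pair4_of_ne a b ha hb hab

/-- `I₂ = ∫_{(0,∞)} s ds/(1 + s³) > 0`. -/
theorem I2_pos : 0 < ∫ s in Ioi (0:ℝ), s / (1 + s ^ 3) := by
  have hint : IntegrableOn (fun s : ℝ => s / (1 + s ^ 3)) (Ioi 0) := by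
    have h := integrableOn_lin_cube 1 one_pos
    simpa using h
  rw [setIntegral_pos_iff_support_of_nonneg_ae ?_ hint]
  · have hsupp : Function.support (fun s : ℝ => s / (1 + s ^ 3)) ∩ Ioi 0 = Ioi 0 := by
      ext s
      simp only [mem_inter_iff, Function.mem_support, mem_Ioi, ne_eq]
      constructor
      · exact fun h => h.2
      · intro hs
        refine ⟨?_, hs⟩
        have : 0 < s / (1 + s ^ 3) := by positivity
        exact ne_of_gt this
    rw [hsupp, Real.volume_Ioi]
    exact ENNReal.zero_lt_top
  · rw [EventuallyLE, ae_restrict_iff' measurableSet_Ioi]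
    exact Filter.Eventually.of_forall fun s hs => by
      have : (0:ℝ) < s := hs
      simp only [Pi.zero_apply]
      positivity

end MixedGauge

end Summit.ValiantsHypothesis.ValiantsHypothesis.Theorems.KPlusLogSqLaw
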